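import Literature.Analysis.FluidPDE.ParabolicSingularPotentials
import HarnessLib

/-!
# Parabolic size and regularity bounds for the forward heat kernel `W₊`

Analysis/FluidPDE file in the decomposition of the named fact
`Literature.Analysis.FluidPDE.LemarieRieusset2016.prop13_4` (Lemarié-Rieusset 2016, Prop. 13.4,
p. 464; `ParabolicHeatPotentials.lean`), the `f`-part of which is the Hölder continuity of the
heat potential `∫₀ᵗ W_{ν(t-s)} * f(s) ds` of parabolic-Morrey data. The printed proof (p. 465)
quotes "the size estimates on `W₊` … `|W₊(t,x)| ≤ Cρ₂(t,x)⁻³`, `|∂ₜW₊(t,x)| ≤ Cρ₂(t,x)⁻⁵`,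
`|∇W₊(t,x)| ≤ Cρ₂(t,x)⁻⁴`" from Ladyzhenskaya–Solonnikov–Ural'tseva. This file **proves** them
for the accepted `heatKernelFwd ν (τ, y) = 1_{τ>0} W_{ντ}(y)` on `ℝ × ℝ³`, in the form consumed
by the abstract Hölder theorem `parabolicHolderOnWith_integral_of_kernel_bounds`
(`ParabolicSingularPotentials.lean`, `m = 3`):

* the Gaussian tail bound `e^{-s} ≤ 2ⁿ(1 + n!)(1 + s)⁻ⁿ` and its consequence
  `W_{ντ}(y) ≤ Gₙ(ν) (√τ)^{2n-3} / ρ₂(τ, y)^{2n}` (`heatKernel_le_sqrt_pow_div`), in particular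
  `W₊ ≤ G₃ (√τ)³ ρ₂⁻⁶ ≤ G₃ ρ₂⁻³` and `W₊ ≤ G₄ (√τ)⁵ ρ₂⁻⁸`;
* the size bound `|W₊(z)| ρ₂(z)³ ≤ A` (`heatKernelFwd_mul_parabolicNorm_pow_le`);
* the derivatives of `θ ↦ W_{ντ}(a + θb)` and `τ ↦ W_{ντ}(y)` with the bounds
  `|∇W₊| ≤ Cρ₂⁻⁴`, `|∂τW₊| ≤ Cρ₂⁻⁵` along segments, and from them the regularity bound
  `|W₊(z) - W₊(z - z')| ρ₂(z)⁴ ≤ A ρ₂(z')` for `2ρ₂(z') ≤ ρ₂(z)`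
  (`heatKernelFwd_sub_mul_parabolicNorm_pow_le`; across `τ = 0` the kernel vanishes to infinite
  order, and the two one-sided cases are settled by the improved size bound `W₊ ≤ G₃(√τ)³ρ₂⁻⁶`);
* the absolute convergence of the heat potential of time-cut `L¹`-Morrey data at every point
  (`integrable_heatKernelFwd_mul`): near the pole by the dyadic estimate with `m = 3 < d`, far
  from it by `W₊ ≤ G₃ (√L)³ ρ₂⁻⁶` on the slab `0 < τ < L` and the dyadic estimate with `m = 5`.

## References

* P. G. Lemarié-Rieusset, *The Navier–Stokes Problem in the 21st Century*, CRC Press (2016),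
  Prop. 13.4, proof, p. 465. [LemarieRieusset2016]
* O. A. Ladyzhenskaya, V. A. Solonnikov, N. N. Ural'tseva, *Linear and quasi-linear equations of
  parabolic type*, AMS (1968), Ch. IV, §1, the estimates of the fundamental solution.
-/

noncomputable section

open MeasureTheory Set Function Filter Metric Real
open scoped NNReal ENNReal RealInnerProductSpace

namespace Literature.Analysis.FluidPDE

/-- Local notation for physical space `ℝ³ = EuclideanSpace ℝ (Fin 3)`. -/
local notation "ℝ³" => EuclideanSpace ℝ (Fin 3)

/-! ### Gaussian tail bounds -/

section Gaussian

/-- The Gauss–Weierstrass kernel in dimension three: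
`W_t(x) = (4πt)^{-3/2} exp(-|x|²/(4t))`. [folklore] -/
theorem heatKernel_three (t : ℝ) (x : ℝ³) :
    UnboundedOperators.heatKernel t x = (4 * π * t) ^ (-(3 : ℝ) / 2) * Real.exp (-‖x‖ ^ 2 / (4 * t)) := by
  simp [UnboundedOperators.heatKernel]

/-- **Gaussian tail bound**: `e^{-s} ≤ 2ⁿ (1 + n!) / (1 + s)ⁿ` for `s ≥ 0` (for `s ≤ 1` because
`(1 + s)ⁿ ≤ 2ⁿ`, for `s > 1` because `(1 + s)ⁿ ≤ 2ⁿ sⁿ ≤ 2ⁿ n! eˢ`). [folklore] -/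
theorem exp_neg_le_div_one_add_pow {s : ℝ} (hs : 0 ≤ s) (n : ℕ) :
    Real.exp (-s) ≤ 2 ^ n * (1 + n.factorial) / (1 + s) ^ n := by
  have hexp : 0 < Real.exp s := Real.exp_pos s
  have hfac : (1 : ℝ) ≤ 1 + n.factorial := by
    have : (0 : ℝ) ≤ n.factorial := by positivity
    linarith
  have key : (1 + s) ^ n ≤ 2 ^ n * (1 + n.factorial) * Real.exp s := by
    rcases le_or_gt s 1 with h | h
    · calc (1 + s) ^ n ≤ 2 ^ n := pow_le_pow_left₀ (by linarith) (by linarith) n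
        _ = 2 ^ n * 1 * 1 := by ring
        _ ≤ 2 ^ n * (1 + n.factorial) * Real.exp s := by
            gcongr
            exact Real.one_le_exp hs
    · have h1 : s ^ n ≤ n.factorial * Real.exp s := by
        have := Real.pow_div_factorial_le_exp (x := s) hs n
        rw [div_le_iff₀ (by positivity)] at this
        linarith
      calc (1 + s) ^ n ≤ (2 * s) ^ n := pow_le_pow_left₀ (by linarith) (by linarith) n
        _ = 2 ^ n * s ^ n := mul_pow 2 s n
        _ ≤ 2 ^ n * (n.factorial * Real.exp s) := by gcongr
        _ ≤ 2 ^ n * ((1 + n.factorial) * Real.exp s) := by gcongr; linarith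
        _ = 2 ^ n * (1 + n.factorial) * Real.exp s := by ring
  rw [Real.exp_neg, inv_eq_one_div, div_le_div_iff₀ hexp (by positivity), one_mul]
  linarith [key]

/-- **Polynomial decay of the heat kernel**: for `t > 0` and every `n`,
`W_t(y) ≤ 2ⁿ(1 + n!) (4πt)^{-3/2} (4t)ⁿ / (4t + |y|²)ⁿ` (the Gaussian tail bound with
`s = |y|²/(4t)`, `1 + s = (4t + |y|²)/(4t)`). [folklore] -/
theorem heatKernel_le_tail {t : ℝ} (ht : 0 < t) (n : ℕ) (y : ℝ³) :
    UnboundedOperators.heatKernel t y ≤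
      2 ^ n * (1 + n.factorial) * (4 * π * t) ^ (-(3 : ℝ) / 2) * (4 * t) ^ n /
        (4 * t + ‖y‖ ^ 2) ^ n := by
  rw [heatKernel_three]
  have hs : Real.exp (-(‖y‖ ^ 2 / (4 * t))) ≤
      2 ^ n * (1 + n.factorial) / (1 + ‖y‖ ^ 2 / (4 * t)) ^ n :=
    exp_neg_le_div_one_add_pow (by positivity) n
  have h1s : 1 + ‖y‖ ^ 2 / (4 * t) = (4 * t + ‖y‖ ^ 2) / (4 * t) := by
    field_simp
  rw [h1s, div_pow, div_div_eq_mul_div] at hs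
  have hc : 0 ≤ (4 * π * t) ^ (-(3 : ℝ) / 2) := by positivity
  calc (4 * π * t) ^ (-(3 : ℝ) / 2) * Real.exp (-‖y‖ ^ 2 / (4 * t))
      = (4 * π * t) ^ (-(3 : ℝ) / 2) * Real.exp (-(‖y‖ ^ 2 / (4 * t))) := by
          rw [neg_div (4 * t) (‖y‖ ^ 2)]
    _ ≤ (4 * π * t) ^ (-(3 : ℝ) / 2) * (2 ^ n * (1 + n.factorial) * (4 * t) ^ n /
          (4 * t + ‖y‖ ^ 2) ^ n) := mul_le_mul_of_nonneg_left hs hc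
    _ = _ := by ring

end Gaussian

/-! ### The parabolic norm of `(τ, y)` for `τ ≥ 0` -/

section Norm

/-- For `τ ≥ 0`, `ρ₂(τ, y) = √τ + |y|`. [folklore] -/
theorem parabolicNorm_mk_of_nonneg {τ : ℝ} (hτ : 0 ≤ τ) (y : ℝ³) :
    parabolicNorm ((τ, y) : ℝ × ℝ³) = Real.sqrt τ + ‖y‖ := by
  simp [parabolicNorm, abs_of_nonneg hτ]

/-- In general `ρ₂(τ, y) = √|τ| + |y|`. [folklore] -/
theorem parabolicNorm_mk (τ : ℝ) (y : ℝ³) :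
    parabolicNorm ((τ, y) : ℝ × ℝ³) = Real.sqrt |τ| + ‖y‖ :=
  rfl

/-- `√|τ| ≤ ρ₂(τ, y)`. [folklore] -/
theorem sqrt_abs_le_parabolicNorm (τ : ℝ) (y : ℝ³) :
    Real.sqrt |τ| ≤ parabolicNorm ((τ, y) : ℝ × ℝ³) := by
  rw [parabolicNorm_mk]
  linarith [norm_nonneg y]

/-- `|y| ≤ ρ₂(τ, y)`. [folklore] -/
theorem norm_le_parabolicNorm (τ : ℝ) (y : ℝ³) : ‖y‖ ≤ parabolicNorm ((τ, y) : ℝ × ℝ³) := by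
  rw [parabolicNorm_mk]
  linarith [Real.sqrt_nonneg |τ|]

/-- `|τ| ≤ ρ₂(τ, y)²`. [folklore] -/
theorem abs_le_parabolicNorm_sq (τ : ℝ) (y : ℝ³) : |τ| ≤ parabolicNorm ((τ, y) : ℝ × ℝ³) ^ 2 := by
  have h := sqrt_abs_le_parabolicNorm τ y
  have h0 : 0 ≤ Real.sqrt |τ| := Real.sqrt_nonneg _
  calc |τ| = Real.sqrt |τ| ^ 2 := (Real.sq_sqrt (abs_nonneg τ)).symm
    _ ≤ parabolicNorm ((τ, y) : ℝ × ℝ³) ^ 2 := pow_le_pow_left₀ h0 h 2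

/-- The parabolic norm of `(τ, y)` is monotone in `τ ≥ 0`. [folklore] -/
theorem parabolicNorm_mk_mono {τ₁ τ₂ : ℝ} (h₁ : 0 ≤ τ₁) (h : τ₁ ≤ τ₂) (y : ℝ³) :
    parabolicNorm ((τ₁, y) : ℝ × ℝ³) ≤ parabolicNorm ((τ₂, y) : ℝ × ℝ³) := by
  rw [parabolicNorm_mk_of_nonneg h₁, parabolicNorm_mk_of_nonneg (h₁.trans h)]
  linarith [Real.sqrt_le_sqrt h]

/-- **`4ντ + |y|² ≥ κ ρ₂(τ, y)²`** with `κ = min(4ν, 1)/2`, for `τ ≥ 0`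
(`ρ₂² = (√τ + |y|)² ≤ 2(τ + |y|²)`). [folklore] -/
theorem kappa_mul_parabolicNorm_sq_le {ν τ : ℝ} (hν : 0 < ν) (hτ : 0 ≤ τ) (y : ℝ³) :
    min (4 * ν) 1 / 2 * parabolicNorm ((τ, y) : ℝ × ℝ³) ^ 2 ≤ 4 * ν * τ + ‖y‖ ^ 2 := by
  rw [parabolicNorm_mk_of_nonneg hτ]
  have hsq : (Real.sqrt τ + ‖y‖) ^ 2 ≤ 2 * (τ + ‖y‖ ^ 2) := by
    nlinarith [Real.sq_sqrt hτ, sq_nonneg (Real.sqrt τ - ‖y‖)]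
  have hmin1 : min (4 * ν) 1 ≤ 4 * ν := min_le_left _ _
  have hmin2 : min (4 * ν) 1 ≤ 1 := min_le_right _ _
  have hmin0 : 0 < min (4 * ν) 1 := lt_min (by linarith) one_pos
  have hy : 0 ≤ ‖y‖ ^ 2 := by positivity
  calc min (4 * ν) 1 / 2 * (Real.sqrt τ + ‖y‖) ^ 2 ≤ min (4 * ν) 1 / 2 * (2 * (τ + ‖y‖ ^ 2)) :=
        mul_le_mul_of_nonneg_left hsq (by positivity)
    _ = min (4 * ν) 1 * τ + min (4 * ν) 1 * ‖y‖ ^ 2 := by ring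
    _ ≤ 4 * ν * τ + 1 * ‖y‖ ^ 2 :=
        add_le_add (mul_le_mul_of_nonneg_right hmin1 hτ) (mul_le_mul_of_nonneg_right hmin2 hy)
    _ = 4 * ν * τ + ‖y‖ ^ 2 := by ring

end Norm

/-! ### Parabolic size bounds for `W_{ντ}` -/

section Size

/-- The constant `Gₙ(ν) = 2ⁿ(1 + n!) (4πν)^{-3/2} (4ν)ⁿ κ⁻ⁿ`, `κ = min(4ν,1)/2`, of
`heatKernel_le_sqrt_pow_div`. [folklore] -/
def gaussConst (ν : ℝ) (n : ℕ) : ℝ :=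
  2 ^ n * (1 + n.factorial) * (4 * π * ν) ^ (-(3 : ℝ) / 2) * (4 * ν) ^ n / (min (4 * ν) 1 / 2) ^ n

/-- The constant `Gₙ(ν)` is nonnegative. [folklore] -/
theorem gaussConst_nonneg {ν : ℝ} (hν : 0 < ν) (n : ℕ) : 0 ≤ gaussConst ν n := by
  unfold gaussConst
  have : 0 < min (4 * ν) 1 := lt_min (by linarith) one_pos
  positivity

/-- `τ^{-3/2} = 1/(√τ)³` for `τ > 0`. [folklore] -/
theorem rpow_neg_three_halves {τ : ℝ} (hτ : 0 < τ) : τ ^ (-(3 : ℝ) / 2) = 1 / Real.sqrt τ ^ 3 := by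
  rw [show (-(3 : ℝ) / 2) = -((1 / 2) * 3) by norm_num, Real.rpow_neg hτ.le, Real.rpow_mul hτ.le,
    ← Real.sqrt_eq_rpow, one_div]
  norm_cast

/-- **Parabolic decay of the heat kernel**: for `ν, τ > 0`, `n ≥ 2` and `y ∈ ℝ³`,
`W_{ντ}(y) ≤ Gₙ(ν) (√τ)^{2n-3} / ρ₂(τ, y)^{2n}` (from `heatKernel_le_tail` with
`4ντ + |y|² ≥ κρ₂²`, `(4πντ)^{-3/2} = (4πν)^{-3/2} (√τ)⁻³`, `τⁿ = (√τ)^{2n}`). [folklore] -/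
theorem heatKernel_le_sqrt_pow_div {ν τ : ℝ} (hν : 0 < ν) (hτ : 0 < τ) {n : ℕ} (hn : 2 ≤ n)
    (y : ℝ³) :
    UnboundedOperators.heatKernel (ν * τ) y ≤
      gaussConst ν n * Real.sqrt τ ^ (2 * n - 3) / parabolicNorm ((τ, y) : ℝ × ℝ³) ^ (2 * n) := by
  set ρ : ℝ := parabolicNorm ((τ, y) : ℝ × ℝ³) with hρ
  set a : ℝ := Real.sqrt τ with ha
  have ha0 : 0 < a := Real.sqrt_pos.2 hτ
  have ha2 : a ^ 2 = τ := Real.sq_sqrt hτ.le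
  have hρa : a ≤ ρ := by
    rw [hρ, parabolicNorm_mk_of_nonneg hτ.le]
    linarith [norm_nonneg y]
  have hρ0 : 0 < ρ := ha0.trans_le hρa
  set κ : ℝ := min (4 * ν) 1 / 2 with hκ
  have hκ0 : 0 < κ := by
    have : 0 < min (4 * ν) 1 := lt_min (by linarith) one_pos
    rw [hκ]; positivity
  have hden : κ * ρ ^ 2 ≤ 4 * (ν * τ) + ‖y‖ ^ 2 := by
    have := kappa_mul_parabolicNorm_sq_le hν hτ.le y
    rw [← hκ, ← hρ] at this
    linarith
  have hden0 : 0 < κ * ρ ^ 2 := by positivity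
  -- the tail bound at heat time `ν τ`
  have H := heatKernel_le_tail (mul_pos hν hτ) n y
  -- rewrite the constant
  have hc : (4 * π * (ν * τ)) ^ (-(3 : ℝ) / 2) = (4 * π * ν) ^ (-(3 : ℝ) / 2) * (1 / a ^ 3) := by
    rw [show 4 * π * (ν * τ) = (4 * π * ν) * τ by ring,
      Real.mul_rpow (by positivity) hτ.le, rpow_neg_three_halves hτ]
  have hpow : (4 * (ν * τ)) ^ n = (4 * ν) ^ n * a ^ (2 * n) := by
    rw [pow_mul, ha2]
    ring
  have hnum0 : 0 ≤ 2 ^ n * (1 + (n.factorial : ℝ)) * (4 * π * (ν * τ)) ^ (-(3 : ℝ) / 2) *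
      (4 * (ν * τ)) ^ n := by positivity
  calc UnboundedOperators.heatKernel (ν * τ) y
      ≤ 2 ^ n * (1 + n.factorial) * (4 * π * (ν * τ)) ^ (-(3 : ℝ) / 2) * (4 * (ν * τ)) ^ n /
          (4 * (ν * τ) + ‖y‖ ^ 2) ^ n := H
    _ ≤ 2 ^ n * (1 + n.factorial) * (4 * π * (ν * τ)) ^ (-(3 : ℝ) / 2) * (4 * (ν * τ)) ^ n /
          (κ * ρ ^ 2) ^ n := by
        apply div_le_div_of_nonneg_left hnum0 (pow_pos hden0 n)
        exact pow_le_pow_left₀ hden0.le hden n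
    _ = gaussConst ν n * (a ^ (2 * n) / a ^ 3) / ρ ^ (2 * n) := by
        rw [hc, hpow, gaussConst, ← hκ, mul_pow, pow_mul ρ 2 n]
        field_simp
        ring
    _ = gaussConst ν n * a ^ (2 * n - 3) / ρ ^ (2 * n) := by
        rw [pow_sub₀ a ha0.ne' (by omega : 3 ≤ 2 * n), div_eq_mul_inv (a ^ (2 * n))]

/-- `W_{ντ}(y) ≤ G₃(ν) (√τ)³ / ρ₂(τ,y)⁶`. [folklore] -/
theorem heatKernel_le_G3 {ν τ : ℝ} (hν : 0 < ν) (hτ : 0 < τ) (y : ℝ³) :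
    UnboundedOperators.heatKernel (ν * τ) y ≤
      gaussConst ν 3 * Real.sqrt τ ^ 3 / parabolicNorm ((τ, y) : ℝ × ℝ³) ^ 6 := by
  simpa using heatKernel_le_sqrt_pow_div hν hτ (n := 3) (by norm_num) y

/-- `W_{ντ}(y) ≤ G₄(ν) (√τ)⁵ / ρ₂(τ,y)⁸`. [folklore] -/
theorem heatKernel_le_G4 {ν τ : ℝ} (hν : 0 < ν) (hτ : 0 < τ) (y : ℝ³) :
    UnboundedOperators.heatKernel (ν * τ) y ≤
      gaussConst ν 4 * Real.sqrt τ ^ 5 / parabolicNorm ((τ, y) : ℝ × ℝ³) ^ 8 := by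
  simpa using heatKernel_le_sqrt_pow_div hν hτ (n := 4) (by norm_num) y

/-- The forward kernel is nonnegative. [folklore] -/
theorem heatKernelFwd_nonneg {ν : ℝ} (hν : 0 < ν) (w : ℝ × ℝ³) : 0 ≤ heatKernelFwd ν w := by
  unfold heatKernelFwd
  split_ifs with h
  · exact (UnboundedOperators.heatKernel_pos (mul_pos hν h) _).le
  · exact le_rfl

/-- **Size bound `|W₊(z)| ρ₂(z)³ ≤ G₃(ν)`** (Lemarié-Rieusset 2016, p. 465: `|W₊| ≤ Cρ₂⁻³`), in
the form consumed by `parabolicHolderOnWith_integral_of_kernel_bounds` with `m = 3`. [cite: LemarieRieusset2016, Prop. 13.4 proof p. 465] -/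
theorem heatKernelFwd_mul_parabolicNorm_pow_le {ν : ℝ} (hν : 0 < ν) (z : ℝ × ℝ³) :
    ‖((heatKernelFwd ν z : ℝ) : ℂ)‖ * parabolicNorm z ^ (3 : ℝ) ≤ gaussConst ν 3 := by
  rw [Complex.norm_real, Real.norm_eq_abs, abs_of_nonneg (heatKernelFwd_nonneg hν z),
    show (3 : ℝ) = ((3 : ℕ) : ℝ) by norm_num, Real.rpow_natCast]
  rcases le_or_gt z.1 0 with hτ | hτ
  · rw [heatKernelFwd_of_nonpos ν hτ, zero_mul]
    exact gaussConst_nonneg hν 3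
  · rw [heatKernelFwd_of_pos ν hτ]
    obtain ⟨τ, y⟩ := z
    simp only at hτ ⊢
    set ρ : ℝ := parabolicNorm ((τ, y) : ℝ × ℝ³) with hρ
    set a : ℝ := Real.sqrt τ with ha
    have ha0 : 0 < a := Real.sqrt_pos.2 hτ
    have hρa : a ≤ ρ := by
      rw [hρ, parabolicNorm_mk_of_nonneg hτ.le]
      linarith [norm_nonneg y]
    have hρ0 : 0 < ρ := ha0.trans_le hρa
    have H := heatKernel_le_G3 hν hτ y
    rw [← hρ, ← ha] at H
    have hG := gaussConst_nonneg hν 3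
    calc UnboundedOperators.heatKernel (ν * τ) y * ρ ^ 3
        ≤ gaussConst ν 3 * a ^ 3 / ρ ^ 6 * ρ ^ 3 := mul_le_mul_of_nonneg_right H (by positivity)
      _ = gaussConst ν 3 * (a ^ 3 / ρ ^ 3) := by field_simp
      _ ≤ gaussConst ν 3 * 1 := by
          apply mul_le_mul_of_nonneg_left _ hG
          rw [div_le_one (by positivity)]
          exact pow_le_pow_left₀ ha0.le hρa 3
      _ = gaussConst ν 3 := mul_one _

end Size

/-! ### Derivatives of the heat kernel -/

section Deriv

/-- **Derivative of the heat kernel along a spatial segment**: for `t > 0`,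
`d/dθ W_t(a + θb) = -W_t(a + θb) ⟨a + θb, b⟩ / (2t)`. [folklore] -/
theorem hasDerivAt_heatKernel_segment {t : ℝ} (ht : 0 < t) (a b : ℝ³) (θ : ℝ) :
    HasDerivAt (fun θ : ℝ => UnboundedOperators.heatKernel t (a + θ • b))
      (-(UnboundedOperators.heatKernel t (a + θ • b) * (⟪a + θ • b, b⟫ / (2 * t)))) θ := by
  have hq : ∀ θ : ℝ, ‖a + θ • b‖ ^ 2 = ‖a‖ ^ 2 + 2 * ⟪a, b⟫ * θ + ‖b‖ ^ 2 * θ ^ 2 := by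
    intro θ
    rw [norm_add_sq_real, inner_smul_right, norm_smul, mul_pow, Real.norm_eq_abs, sq_abs]
    ring
  have hinner : ⟪a + θ • b, b⟫ = ⟪a, b⟫ + θ * ‖b‖ ^ 2 := by
    rw [inner_add_left, real_inner_smul_left, real_inner_self_eq_norm_sq]
  set c : ℝ := (4 * π * t) ^ (-(3 : ℝ) / 2) with hc
  set A : ℝ := -‖a‖ ^ 2 / (4 * t) with hA
  set B : ℝ := -(2 * ⟪a, b⟫) / (4 * t) with hB
  set C : ℝ := -‖b‖ ^ 2 / (4 * t) with hC
  have harg : ∀ θ : ℝ,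
      -(‖a‖ ^ 2 + 2 * ⟪a, b⟫ * θ + ‖b‖ ^ 2 * θ ^ 2) / (4 * t) = A + B * θ + C * θ ^ 2 := by
    intro θ
    rw [hA, hB, hC]
    field_simp
    ring
  have hfun : (fun θ : ℝ => UnboundedOperators.heatKernel t (a + θ • b)) =
      fun θ => c * Real.exp (A + B * θ + C * θ ^ 2) := by
    funext θ
    rw [heatKernel_three, hq, harg]
  rw [hfun]
  have hpoly : HasDerivAt (fun θ : ℝ => A + B * θ + C * θ ^ 2) (B + C * (2 * θ)) θ := by
    have h₁ := ((hasDerivAt_id θ).const_mul B).const_add A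
    have h₂ := (hasDerivAt_pow 2 θ).const_mul C
    have h₃ := h₁.add h₂
    refine HasDerivAt.congr_deriv (h₃.congr_of_eventuallyEq ?_) ?_
    · exact Filter.Eventually.of_forall fun x => by simp
    · norm_num
  have h3 := (hpoly.exp).const_mul c
  refine h3.congr_deriv ?_
  rw [heatKernel_three, hq, harg, hinner, ← hc, hB, hC]
  field_simp
  ring

/-- **Derivative of the heat kernel in time**: for `ν, τ > 0`,
`d/dτ W_{ντ}(y) = W_{ντ}(y) (-3/(2τ) + |y|²/(4ντ²))`. [folklore] -/
theorem hasDerivAt_heatKernel_time {ν : ℝ} (hν : 0 < ν) {τ : ℝ} (hτ : 0 < τ) (y : ℝ³) :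
    HasDerivAt (fun s : ℝ => UnboundedOperators.heatKernel (ν * s) y)
      (UnboundedOperators.heatKernel (ν * τ) y * (-3 / (2 * τ) + ‖y‖ ^ 2 / (4 * ν * τ ^ 2))) τ := by
  -- the explicit form for `s > 0`
  have hbase : ∀ s : ℝ, 4 * π * (ν * s) = 4 * π * ν * s := fun s => by ring
  have harg : ∀ s : ℝ, 0 < s → -‖y‖ ^ 2 / (4 * (ν * s)) = -‖y‖ ^ 2 / (4 * ν) * s⁻¹ := by
    intro s hs
    field_simp
  have hge : ∀ s : ℝ, 0 < s → UnboundedOperators.heatKernel (ν * s) y =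
      (4 * π * ν * s) ^ (-(3 : ℝ) / 2) * Real.exp (-‖y‖ ^ 2 / (4 * ν) * s⁻¹) := by
    intro s hs
    rw [heatKernel_three, hbase, harg s hs]
  have hev : (fun s : ℝ => (4 * π * ν * s) ^ (-(3 : ℝ) / 2) * Real.exp (-‖y‖ ^ 2 / (4 * ν) * s⁻¹))
      =ᶠ[nhds τ] fun s : ℝ => UnboundedOperators.heatKernel (ν * s) y := by
    filter_upwards [Ioi_mem_nhds hτ] with s hs
    exact (hge s hs).symm
  have hne : 4 * π * ν * τ ≠ 0 := by positivity
  -- derivative of the explicit form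
  have hlin : HasDerivAt (fun s : ℝ => 4 * π * ν * s) (4 * π * ν) τ := by
    simpa using (hasDerivAt_id τ).const_mul (4 * π * ν)
  have hpow : HasDerivAt (fun s : ℝ => (4 * π * ν * s) ^ (-(3 : ℝ) / 2))
      (4 * π * ν * (-(3 : ℝ) / 2) * (4 * π * ν * τ) ^ (-(3 : ℝ) / 2 - 1)) τ :=
    hlin.rpow_const (Or.inl hne)
  have hexp : HasDerivAt (fun s : ℝ => Real.exp (-‖y‖ ^ 2 / (4 * ν) * s⁻¹))
      (Real.exp (-‖y‖ ^ 2 / (4 * ν) * τ⁻¹) * (-‖y‖ ^ 2 / (4 * ν) * (-(τ ^ 2)⁻¹))) τ :=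
    ((hasDerivAt_inv hτ.ne').const_mul (-‖y‖ ^ 2 / (4 * ν))).exp
  have hprod := hpow.mul hexp
  refine (hprod.congr_of_eventuallyEq hev.symm).congr_deriv ?_
  rw [hge τ hτ, Real.rpow_sub_one hne]
  field_simp

end Deriv

/-! ### Bounds for the derivatives along segments -/

section DerivBounds

/-- The constant of the spatial-derivative bound, `G₃(ν)/(2ν)`. [folklore] -/
def spaceDerivConst (ν : ℝ) : ℝ := gaussConst ν 3 / (2 * ν)

/-- The constant of the time-derivative bound, `3G₃(ν)/2 + G₄(ν)/(4ν)`. [folklore] -/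
def timeDerivConst (ν : ℝ) : ℝ := 3 * gaussConst ν 3 / 2 + gaussConst ν 4 / (4 * ν)

/-- `spaceDerivConst ν ≥ 0`. [folklore] -/
theorem spaceDerivConst_nonneg {ν : ℝ} (hν : 0 < ν) : 0 ≤ spaceDerivConst ν := by
  unfold spaceDerivConst
  have := gaussConst_nonneg hν 3
  positivity

/-- `timeDerivConst ν ≥ 0`. [folklore] -/
theorem timeDerivConst_nonneg {ν : ℝ} (hν : 0 < ν) : 0 ≤ timeDerivConst ν := by
  unfold timeDerivConst
  have := gaussConst_nonneg hν 3
  have := gaussConst_nonneg hν 4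
  positivity

/-- **`|∇W₊| ≤ Cρ₂⁻⁴` along a direction**: for `ν, τ > 0`,
`W_{ντ}(ỹ) |⟨ỹ, b⟩| / (2ντ) ≤ (G₃/(2ν)) |b| / ρ₂(τ, ỹ)⁴`
(`W ≤ G₃(√τ)³ρ₂⁻⁶`, `|⟨ỹ, b⟩| ≤ |ỹ||b|`, `√τ, |ỹ| ≤ ρ₂`). [cite: LemarieRieusset2016, Prop. 13.4 proof p. 465] -/
theorem heatKernel_spaceDeriv_le {ν τ : ℝ} (hν : 0 < ν) (hτ : 0 < τ) (v b : ℝ³) :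
    UnboundedOperators.heatKernel (ν * τ) v * (|⟪v, b⟫| / (2 * (ν * τ))) ≤
      spaceDerivConst ν * ‖b‖ / parabolicNorm ((τ, v) : ℝ × ℝ³) ^ 4 := by
  set ρ : ℝ := parabolicNorm ((τ, v) : ℝ × ℝ³) with hρ
  set a : ℝ := Real.sqrt τ with ha
  set W : ℝ := UnboundedOperators.heatKernel (ν * τ) v with hW
  set G : ℝ := gaussConst ν 3 with hG
  have ha0 : 0 < a := Real.sqrt_pos.2 hτ
  have ha2 : a ^ 2 = τ := Real.sq_sqrt hτ.le
  have hρa : a ≤ ρ := by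
    rw [hρ, parabolicNorm_mk_of_nonneg hτ.le]; linarith [norm_nonneg v]
  have hρv : ‖v‖ ≤ ρ := norm_le_parabolicNorm τ v
  have hρ0 : 0 < ρ := ha0.trans_le hρa
  have hW0 : 0 ≤ W := (UnboundedOperators.heatKernel_pos (mul_pos hν hτ) v).le
  have hG0 : 0 ≤ G := gaussConst_nonneg hν 3
  have hWb : W ≤ G * a ^ 3 / ρ ^ 6 := heatKernel_le_G3 hν hτ v
  have hWρ : W * ρ ^ 6 ≤ G * a ^ 3 := by
    rwa [le_div_iff₀ (by positivity)] at hWb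
  have hinner : |⟪v, b⟫| ≤ ‖v‖ * ‖b‖ := abs_real_inner_le_norm v b
  -- reduce to a polynomial inequality
  have lhs : W * (|⟪v, b⟫| / (2 * (ν * a ^ 2))) = W * |⟪v, b⟫| / (2 * ν * a ^ 2) := by ring
  have rhs : spaceDerivConst ν * ‖b‖ / ρ ^ 4 = G * ‖b‖ / (2 * ν * ρ ^ 4) := by
    rw [spaceDerivConst, ← hG]
    ring
  rw [← ha2, lhs, rhs, div_le_div_iff₀ (by positivity) (by positivity)]
  -- `W |⟨v,b⟩| (2ν ρ⁴) ≤ G |b| (2ν a²)`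
  have key : W * |⟪v, b⟫| * ρ ^ 4 ≤ G * ‖b‖ * a ^ 2 := by
    calc W * |⟪v, b⟫| * ρ ^ 4 ≤ W * (‖v‖ * ‖b‖) * ρ ^ 4 := by gcongr
      _ ≤ W * (ρ * ‖b‖) * ρ ^ 4 := by gcongr
      _ = W * ρ ^ 6 * ‖b‖ / ρ := by field_simp
      _ ≤ G * a ^ 3 * ‖b‖ / ρ := by gcongr
      _ = G * ‖b‖ * a ^ 2 * (a / ρ) := by field_simp
      _ ≤ G * ‖b‖ * a ^ 2 * 1 := by
          apply mul_le_mul_of_nonneg_left _ (by positivity)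
          rw [div_le_one hρ0]; exact hρa
      _ = G * ‖b‖ * a ^ 2 := mul_one _
  calc W * |⟪v, b⟫| * (2 * ν * ρ ^ 4) = 2 * ν * (W * |⟪v, b⟫| * ρ ^ 4) := by ring
    _ ≤ 2 * ν * (G * ‖b‖ * a ^ 2) := by gcongr
    _ = G * ‖b‖ * (2 * ν * a ^ 2) := by ring

/-- **`|∂τW₊| ≤ Cρ₂⁻⁵`**: for `ν, s > 0`,
`|W_{νs}(v) (-3/(2s) + |v|²/(4νs²))| ≤ (3G₃/2 + G₄/(4ν)) / ρ₂(s, v)⁵`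
(`W ≤ G₃(√s)³ρ₂⁻⁶` for the first term, `W ≤ G₄(√s)⁵ρ₂⁻⁸` and `|v| ≤ ρ₂` for the second). [cite: LemarieRieusset2016, Prop. 13.4 proof p. 465] -/
theorem heatKernel_timeDeriv_le {ν s : ℝ} (hν : 0 < ν) (hs : 0 < s) (v : ℝ³) :
    |UnboundedOperators.heatKernel (ν * s) v * (-3 / (2 * s) + ‖v‖ ^ 2 / (4 * ν * s ^ 2))| ≤
      timeDerivConst ν / parabolicNorm ((s, v) : ℝ × ℝ³) ^ 5 := by
  set ρ : ℝ := parabolicNorm ((s, v) : ℝ × ℝ³) with hρ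
  set a : ℝ := Real.sqrt s with ha
  set W : ℝ := UnboundedOperators.heatKernel (ν * s) v with hW
  set G : ℝ := gaussConst ν 3 with hG
  set G' : ℝ := gaussConst ν 4 with hG'
  have ha0 : 0 < a := Real.sqrt_pos.2 hs
  have ha2 : a ^ 2 = s := Real.sq_sqrt hs.le
  have hρa : a ≤ ρ := by
    rw [hρ, parabolicNorm_mk_of_nonneg hs.le]; linarith [norm_nonneg v]
  have hρv : ‖v‖ ≤ ρ := norm_le_parabolicNorm s v
  have hρ0 : 0 < ρ := ha0.trans_le hρa
  have hW0 : 0 ≤ W := (UnboundedOperators.heatKernel_pos (mul_pos hν hs) v).le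
  have hG0 : 0 ≤ G := gaussConst_nonneg hν 3
  have hG'0 : 0 ≤ G' := gaussConst_nonneg hν 4
  have hW3 : W * ρ ^ 6 ≤ G * a ^ 3 := by
    have := heatKernel_le_G3 hν hs v
    rwa [le_div_iff₀ (by positivity)] at this
  have hW4 : W * ρ ^ 8 ≤ G' * a ^ 5 := by
    have := heatKernel_le_G4 hν hs v
    rwa [le_div_iff₀ (by positivity)] at this
  -- first term: `W · 3/(2s) ≤ (3G/2)/ρ⁵`
  have h1 : W * (3 / (2 * s)) ≤ 3 * G / 2 / ρ ^ 5 := by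
    rw [← ha2, le_div_iff₀ (by positivity)]
    calc W * (3 / (2 * a ^ 2)) * ρ ^ 5 = 3 / 2 * (W * ρ ^ 6) / (a ^ 2 * ρ) := by field_simp
      _ ≤ 3 / 2 * (G * a ^ 3) / (a ^ 2 * ρ) := by gcongr
      _ = 3 * G / 2 * (a / ρ) := by field_simp
      _ ≤ 3 * G / 2 * 1 := by
          apply mul_le_mul_of_nonneg_left _ (by positivity)
          rw [div_le_one hρ0]; exact hρa
      _ = 3 * G / 2 := mul_one _
  -- second term: `W |v|²/(4νs²) ≤ (G'/(4ν))/ρ⁵`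
  have h2 : W * (‖v‖ ^ 2 / (4 * ν * s ^ 2)) ≤ G' / (4 * ν) / ρ ^ 5 := by
    rw [← ha2, le_div_iff₀ (by positivity)]
    calc W * (‖v‖ ^ 2 / (4 * ν * (a ^ 2) ^ 2)) * ρ ^ 5
        = (W * ρ ^ 8) * ‖v‖ ^ 2 / (4 * ν * a ^ 4 * ρ ^ 3) := by field_simp
      _ ≤ (G' * a ^ 5) * ‖v‖ ^ 2 / (4 * ν * a ^ 4 * ρ ^ 3) := by gcongr
      _ ≤ (G' * a ^ 5) * ρ ^ 2 / (4 * ν * a ^ 4 * ρ ^ 3) := by gcongr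
      _ = G' / (4 * ν) * (a / ρ) := by field_simp
      _ ≤ G' / (4 * ν) * 1 := by
          apply mul_le_mul_of_nonneg_left _ (by positivity)
          rw [div_le_one hρ0]; exact hρa
      _ = G' / (4 * ν) := mul_one _
  calc |W * (-3 / (2 * s) + ‖v‖ ^ 2 / (4 * ν * s ^ 2))|
      = |-(W * (3 / (2 * s))) + W * (‖v‖ ^ 2 / (4 * ν * s ^ 2))| := by ring_nf
    _ ≤ |-(W * (3 / (2 * s)))| + |W * (‖v‖ ^ 2 / (4 * ν * s ^ 2))| := abs_add_le _ _
    _ = W * (3 / (2 * s)) + W * (‖v‖ ^ 2 / (4 * ν * s ^ 2)) := by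
        rw [abs_neg, abs_of_nonneg (by positivity), abs_of_nonneg (by positivity)]
    _ ≤ 3 * G / 2 / ρ ^ 5 + G' / (4 * ν) / ρ ^ 5 := add_le_add h1 h2
    _ = timeDerivConst ν / ρ ^ 5 := by rw [timeDerivConst, ← hG, ← hG', add_div]

end DerivBounds

/-! ### The regularity bound -/

section Regularity

/-- The constant of the regularity bound `heatKernelFwd_sub_mul_parabolicNorm_pow_le`. [folklore] -/
def heatRegConst (ν : ℝ) : ℝ :=
  16 * spaceDerivConst ν + 16 * timeDerivConst ν + 16 * gaussConst ν 3

/-- `heatRegConst ν ≥ 0`. [folklore] -/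
theorem heatRegConst_nonneg {ν : ℝ} (hν : 0 < ν) : 0 ≤ heatRegConst ν := by
  unfold heatRegConst
  have := spaceDerivConst_nonneg hν
  have := timeDerivConst_nonneg hν
  have := gaussConst_nonneg hν 3
  positivity

/-- **The one-sided case across `τ = 0`**: if `0 < τ`, `√τ ≤ r`, `2r ≤ ρ₀` and
`ρ₂(τ, v) ≥ ρ₀/2`, then `W_{ντ}(v) ρ₀⁴ ≤ 16 G₃ r` (`W ≤ G₃ (√τ)³ ρ₂⁻⁶ ≤ G₃ r³ (ρ₀/2)⁻⁶` and
`r ≤ ρ₀/2`): the kernel vanishes to infinite order at `τ = 0⁺` away from the origin. [folklore] -/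
theorem heatKernel_mul_pow_four_le {ν τ r ρ₀ : ℝ} (hν : 0 < ν) (hτ : 0 < τ) (v : ℝ³)
    (hr : Real.sqrt τ ≤ r) (hrρ : 2 * r ≤ ρ₀) (hρ : ρ₀ / 2 ≤ parabolicNorm ((τ, v) : ℝ × ℝ³)) :
    UnboundedOperators.heatKernel (ν * τ) v * ρ₀ ^ 4 ≤ 16 * gaussConst ν 3 * r := by
  set ρ : ℝ := parabolicNorm ((τ, v) : ℝ × ℝ³) with hρdef
  set a : ℝ := Real.sqrt τ with ha
  set W : ℝ := UnboundedOperators.heatKernel (ν * τ) v with hW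
  set G : ℝ := gaussConst ν 3 with hG
  have ha0 : 0 < a := Real.sqrt_pos.2 hτ
  have hr0 : 0 < r := ha0.trans_le hr
  have hρ0 : 0 < ρ := by
    have : a ≤ ρ := by rw [hρdef, parabolicNorm_mk_of_nonneg hτ.le]; linarith [norm_nonneg v]
    exact ha0.trans_le this
  have hW0 : 0 ≤ W := (UnboundedOperators.heatKernel_pos (mul_pos hν hτ) v).le
  have hG0 : 0 ≤ G := gaussConst_nonneg hν 3
  have hWρ : W * ρ ^ 6 ≤ G * a ^ 3 := by
    have := heatKernel_le_G3 hν hτ v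
    rwa [le_div_iff₀ (by positivity)] at this
  have hρ₀0 : 0 ≤ ρ₀ := by linarith
  have hρ₀le : ρ₀ ≤ 2 * ρ := by linarith
  have hrρ' : r ≤ ρ := by linarith
  calc W * ρ₀ ^ 4 ≤ W * (2 * ρ) ^ 4 := by gcongr
    _ = 16 * (W * ρ ^ 6) / ρ ^ 2 := by field_simp; ring
    _ ≤ 16 * (G * a ^ 3) / ρ ^ 2 := by gcongr
    _ ≤ 16 * (G * r ^ 3) / ρ ^ 2 := by gcongr
    _ = 16 * G * r * (r / ρ) ^ 2 := by field_simp
    _ ≤ 16 * G * r * 1 := by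
        apply mul_le_mul_of_nonneg_left _ (by positivity)
        exact pow_le_one₀ (by positivity) ((div_le_one hρ0).2 hrρ')
    _ = 16 * gaussConst ν 3 * r := by rw [mul_one, hG]

/-- **Regularity bound `|W₊(z) - W₊(z - z')| ρ₂(z)⁴ ≤ A ρ₂(z')` for `2ρ₂(z') ≤ ρ₂(z)`**
(Lemarié-Rieusset 2016, p. 465: `|∇W₊| ≤ Cρ₂⁻⁴`, `|∂ₜW₊| ≤ Cρ₂⁻⁵`, by the mean value inequality),
in the form consumed by `parabolicHolderOnWith_integral_of_kernel_bounds` with `m = 3`. Proof: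
if both times are `≤ 0` both kernels vanish; if exactly one is positive, that time is at most
`|τ'| ≤ ρ₂(z')²` and `heatKernel_mul_pow_four_le` applies; if both are positive, move first in
space at time `τ` (`heatKernel_spaceDeriv_le` along the segment, which stays at parabolic
distance `≥ ρ₂(z)/2` from the origin) and then in time (`heatKernel_timeDeriv_le`). [cite: LemarieRieusset2016, Prop. 13.4 proof p. 465] -/
theorem heatKernelFwd_sub_mul_parabolicNorm_pow_le {ν : ℝ} (hν : 0 < ν) (z z' : ℝ × ℝ³)
    (hzz' : 2 * parabolicNorm z' ≤ parabolicNorm z) :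
    ‖((heatKernelFwd ν z : ℝ) : ℂ) - ((heatKernelFwd ν (z - z') : ℝ) : ℂ)‖ *
        parabolicNorm z ^ ((3 : ℝ) + 1) ≤ heatRegConst ν * parabolicNorm z' := by
  rw [← Complex.ofReal_sub, Complex.norm_real, Real.norm_eq_abs,
    show (3 : ℝ) + 1 = ((4 : ℕ) : ℝ) by norm_num, Real.rpow_natCast]
  obtain ⟨τ, y⟩ := z
  obtain ⟨τ', y'⟩ := z'
  rw [Prod.mk_sub_mk]
  set ρ₀ : ℝ := parabolicNorm ((τ, y) : ℝ × ℝ³) with hρ₀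
  set r : ℝ := parabolicNorm ((τ', y') : ℝ × ℝ³) with hr
  have hr0 : 0 ≤ r := parabolicNorm_nonneg _
  have hρ₀0 : 0 ≤ ρ₀ := parabolicNorm_nonneg _
  have h2r : 2 * r ≤ ρ₀ := hzz'
  have hC0 : 0 ≤ heatRegConst ν := heatRegConst_nonneg hν
  have hS0 := spaceDerivConst_nonneg hν
  have hT0 := timeDerivConst_nonneg hν
  have hG0 := gaussConst_nonneg hν 3
  have hτ'r : |τ'| ≤ r ^ 2 := abs_le_parabolicNorm_sq τ' y'
  have hy'r : ‖y'‖ ≤ r := norm_le_parabolicNorm τ' y'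
  -- the endpoint `z - z'` is at parabolic distance `≥ ρ₀ / 2` from the origin
  have hρ₂ : ρ₀ / 2 ≤ parabolicNorm ((τ - τ', y - y') : ℝ × ℝ³) := by
    have h := parabolicNorm_add_le ((τ - τ', y - y') : ℝ × ℝ³) ((τ', y') : ℝ × ℝ³)
    have he : ((τ - τ', y - y') : ℝ × ℝ³) + ((τ', y') : ℝ × ℝ³) = (τ, y) := by
      ext <;> simp
    rw [he, ← hρ₀, ← hr] at h
    linarith
  -- the four cases
  have h16 : 16 * gaussConst ν 3 * r ≤ heatRegConst ν * r := by
    unfold heatRegConst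
    nlinarith
  rcases le_or_gt τ 0 with hτ | hτ
  · rcases le_or_gt (τ - τ') 0 with hτ₂ | hτ₂
    · -- both kernels vanish
      rw [heatKernelFwd_of_nonpos ν (show ((τ, y) : ℝ × ℝ³).1 ≤ 0 from hτ),
        heatKernelFwd_of_nonpos ν (show ((τ - τ', y - y') : ℝ × ℝ³).1 ≤ 0 from hτ₂)]
      simp only [sub_self, abs_zero, zero_mul]
      positivity
    · -- `τ ≤ 0 < τ - τ'`
      rw [heatKernelFwd_of_nonpos ν (show ((τ, y) : ℝ × ℝ³).1 ≤ 0 from hτ),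
        heatKernelFwd_of_pos ν (show (0 : ℝ) < ((τ - τ', y - y') : ℝ × ℝ³).1 from hτ₂)]
      dsimp only
      rw [zero_sub, abs_neg,
        abs_of_nonneg (UnboundedOperators.heatKernel_pos (mul_pos hν hτ₂) _).le]
      have hsq : Real.sqrt (τ - τ') ≤ r := by
        rw [Real.sqrt_le_left hr0]
        have : -τ' ≤ |τ'| := neg_le_abs τ'
        linarith
      exact (heatKernel_mul_pow_four_le hν hτ₂ (y - y') hsq h2r hρ₂).trans h16
  · rcases le_or_gt (τ - τ') 0 with hτ₂ | hτ₂
    · -- `τ - τ' ≤ 0 < τ`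
      rw [heatKernelFwd_of_pos ν (show (0 : ℝ) < ((τ, y) : ℝ × ℝ³).1 from hτ),
        heatKernelFwd_of_nonpos ν (show ((τ - τ', y - y') : ℝ × ℝ³).1 ≤ 0 from hτ₂)]
      dsimp only
      rw [sub_zero, abs_of_nonneg (UnboundedOperators.heatKernel_pos (mul_pos hν hτ) _).le]
      have hsq : Real.sqrt τ ≤ r := by
        rw [Real.sqrt_le_left hr0]
        have : τ' ≤ |τ'| := le_abs_self τ'
        linarith
      have hρle : ρ₀ / 2 ≤ parabolicNorm ((τ, y) : ℝ × ℝ³) := by rw [← hρ₀]; linarith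
      exact (heatKernel_mul_pow_four_le hν hτ y hsq h2r hρle).trans h16
    · -- both times positive: mean value in space, then in time
      rw [heatKernelFwd_of_pos ν (show (0 : ℝ) < ((τ, y) : ℝ × ℝ³).1 from hτ),
        heatKernelFwd_of_pos ν (show (0 : ℝ) < ((τ - τ', y - y') : ℝ × ℝ³).1 from hτ₂)]
      dsimp only
      have hρ₀eq : ρ₀ = Real.sqrt τ + ‖y‖ := by rw [hρ₀, parabolicNorm_mk_of_nonneg hτ.le]
      have hρ₀pos : 0 < ρ₀ := by
        rw [hρ₀eq]
        have := Real.sqrt_pos.2 hτ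
        linarith [norm_nonneg y]
      set R : ℝ := ρ₀ / 2 with hR
      have hR0 : 0 < R := by rw [hR]; linarith
      -- the space step
      have D1 : |UnboundedOperators.heatKernel (ν * τ) y -
          UnboundedOperators.heatKernel (ν * τ) (y - y')| ≤ spaceDerivConst ν * ‖y'‖ / R ^ 4 := by
        have hderiv : ∀ θ ∈ Icc (0 : ℝ) 1,
            HasDerivWithinAt (fun θ : ℝ => UnboundedOperators.heatKernel (ν * τ) ((y - y') + θ • y'))
              (-(UnboundedOperators.heatKernel (ν * τ) ((y - y') + θ • y') *
                (⟪(y - y') + θ • y', y'⟫ / (2 * (ν * τ))))) (Icc (0 : ℝ) 1) θ := fun θ _ =>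
          (hasDerivAt_heatKernel_segment (mul_pos hν hτ) (y - y') y' θ).hasDerivWithinAt
        have hbound : ∀ θ ∈ Ico (0 : ℝ) 1,
            ‖-(UnboundedOperators.heatKernel (ν * τ) ((y - y') + θ • y') *
                (⟪(y - y') + θ • y', y'⟫ / (2 * (ν * τ))))‖ ≤ spaceDerivConst ν * ‖y'‖ / R ^ 4 := by
          intro θ hθ
          set v : ℝ³ := (y - y') + θ • y' with hv
          rw [norm_neg, Real.norm_eq_abs, abs_mul,
            abs_of_nonneg (UnboundedOperators.heatKernel_pos (mul_pos hν hτ) v).le, abs_div,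
            abs_of_pos (show (0 : ℝ) < 2 * (ν * τ) by positivity)]
          have hvR : R ≤ parabolicNorm ((τ, v) : ℝ × ℝ³) := by
            rw [parabolicNorm_mk_of_nonneg hτ.le]
            have e : v = y - (1 - θ) • y' := by
              rw [hv, sub_smul, one_smul]
              abel
            have h1 : ‖(1 - θ) • y'‖ ≤ ‖y'‖ := by
              rw [norm_smul, Real.norm_eq_abs, abs_of_nonneg (by linarith [hθ.2])]
              nlinarith [norm_nonneg y', hθ.1, hθ.2]
            have h2 : ‖y‖ - ‖(1 - θ) • y'‖ ≤ ‖v‖ := by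
              rw [e]
              exact norm_sub_norm_le y ((1 - θ) • y')
            rw [hR, hρ₀eq]
            linarith
          calc UnboundedOperators.heatKernel (ν * τ) v * (|⟪v, y'⟫| / (2 * (ν * τ)))
              ≤ spaceDerivConst ν * ‖y'‖ / parabolicNorm ((τ, v) : ℝ × ℝ³) ^ 4 :=
                heatKernel_spaceDeriv_le hν hτ v y'
            _ ≤ spaceDerivConst ν * ‖y'‖ / R ^ 4 :=
                div_le_div_of_nonneg_left (by positivity) (by positivity)
                  (pow_le_pow_left₀ hR0.le hvR 4)
        have := norm_image_sub_le_of_norm_deriv_le_segment_01' hderiv hbound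
        simpa only [one_smul, sub_add_cancel, zero_smul, add_zero, Real.norm_eq_abs] using this
      -- the time step
      have D2 : |UnboundedOperators.heatKernel (ν * τ) (y - y') -
          UnboundedOperators.heatKernel (ν * (τ - τ')) (y - y')| ≤
            timeDerivConst ν / R ^ 5 * |τ'| := by
        set v : ℝ³ := y - y' with hv
        set S : Set ℝ := Icc (min τ (τ - τ')) (max τ (τ - τ')) with hS
        have hSpos : ∀ s ∈ S, 0 < s := fun s hs => (lt_min hτ hτ₂).trans_le hs.1
        have hderiv : ∀ s ∈ S,
            HasDerivWithinAt (fun s : ℝ => UnboundedOperators.heatKernel (ν * s) v)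
              (UnboundedOperators.heatKernel (ν * s) v * (-3 / (2 * s) + ‖v‖ ^ 2 / (4 * ν * s ^ 2)))
              S s := fun s hs =>
          (hasDerivAt_heatKernel_time hν (hSpos s hs) v).hasDerivWithinAt
        have hbound : ∀ s ∈ S,
            ‖UnboundedOperators.heatKernel (ν * s) v * (-3 / (2 * s) + ‖v‖ ^ 2 / (4 * ν * s ^ 2))‖ ≤
              timeDerivConst ν / R ^ 5 := by
          intro s hs
          rw [Real.norm_eq_abs]
          have hmin : R ≤ parabolicNorm ((min τ (τ - τ'), v) : ℝ × ℝ³) := by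
            rcases le_total τ (τ - τ') with h | h
            · rw [min_eq_left h, parabolicNorm_mk_of_nonneg hτ.le]
              have := norm_sub_norm_le y y'
              rw [hR, hρ₀eq, hv]
              linarith
            · rw [min_eq_right h]
              exact hρ₂
          have hρs : R ≤ parabolicNorm ((s, v) : ℝ × ℝ³) :=
            hmin.trans (parabolicNorm_mk_mono (lt_min hτ hτ₂).le hs.1 v)
          calc |UnboundedOperators.heatKernel (ν * s) v * (-3 / (2 * s) + ‖v‖ ^ 2 / (4 * ν * s ^ 2))|
              ≤ timeDerivConst ν / parabolicNorm ((s, v) : ℝ × ℝ³) ^ 5 :=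
                heatKernel_timeDeriv_le hν (hSpos s hs) v
            _ ≤ timeDerivConst ν / R ^ 5 :=
                div_le_div_of_nonneg_left hT0 (by positivity) (pow_le_pow_left₀ hR0.le hρs 5)
        have hconv : Convex ℝ S := convex_Icc _ _
        have hτS : τ ∈ S := ⟨min_le_left _ _, le_max_left _ _⟩
        have hτ₂S : τ - τ' ∈ S := ⟨min_le_right _ _, le_max_right _ _⟩
        have := hconv.norm_image_sub_le_of_norm_hasDerivWithin_le hderiv hbound hτ₂S hτS
        rw [Real.norm_eq_abs, Real.norm_eq_abs, show τ - (τ - τ') = τ' by ring] at this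
        exact this
      -- combine
      have hrR : r / ρ₀ ≤ 1 / 2 := by
        rw [div_le_iff₀ hρ₀pos]
        linarith
      calc |UnboundedOperators.heatKernel (ν * τ) y -
            UnboundedOperators.heatKernel (ν * (τ - τ')) (y - y')| * ρ₀ ^ 4
          ≤ (|UnboundedOperators.heatKernel (ν * τ) y - UnboundedOperators.heatKernel (ν * τ) (y - y')| +
              |UnboundedOperators.heatKernel (ν * τ) (y - y') -
                UnboundedOperators.heatKernel (ν * (τ - τ')) (y - y')|) * ρ₀ ^ 4 := by
            gcongr
            exact abs_sub_le _ _ _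
        _ ≤ (spaceDerivConst ν * ‖y'‖ / R ^ 4 + timeDerivConst ν / R ^ 5 * |τ'|) * ρ₀ ^ 4 := by
            gcongr
        _ ≤ (spaceDerivConst ν * r / R ^ 4 + timeDerivConst ν / R ^ 5 * r ^ 2) * ρ₀ ^ 4 := by
            gcongr
        _ = 16 * spaceDerivConst ν * r + 32 * timeDerivConst ν * r * (r / ρ₀) := by
            rw [hR]
            field_simp
            ring
        _ ≤ 16 * spaceDerivConst ν * r + 32 * timeDerivConst ν * r * (1 / 2) := by gcongr
        _ = (16 * spaceDerivConst ν + 16 * timeDerivConst ν) * r := by ring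
        _ ≤ heatRegConst ν * r := by
            unfold heatRegConst
            nlinarith

end Regularity

/-! ### Measurability and absolute convergence of the heat potential -/

section Convergence

/-- The forward heat kernel is measurable on `ℝ × ℝ³`. [folklore] -/
theorem measurable_heatKernelFwd (ν : ℝ) : Measurable (heatKernelFwd ν : ℝ × ℝ³ → ℝ) := by
  have h1 : Measurable fun w : ℝ × ℝ³ => UnboundedOperators.heatKernel (ν * w.1) w.2 := by
    unfold UnboundedOperators.heatKernel
    fun_prop
  have h2 : (heatKernelFwd ν : ℝ × ℝ³ → ℝ) =
      fun w => if 0 < w.1 then UnboundedOperators.heatKernel (ν * w.1) w.2 else 0 := by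
    funext w
    rfl
  rw [h2]
  exact Measurable.ite (measurableSet_lt measurable_const measurable_fst) h1 measurable_const

/-- The forward heat kernel vanishes at the origin (indeed on `τ ≤ 0`). [folklore] -/
theorem heatKernelFwd_zero (ν : ℝ) : heatKernelFwd ν (0 : ℝ × ℝ³) = 0 :=
  heatKernelFwd_of_nonpos ν (show ((0 : ℝ × ℝ³)).1 ≤ 0 from le_rfl)

/-- **Far-field bound on a time slab**: if `0 < τ ≤ L` then
`W_{ντ}(y) ≤ G₃ (√L)³ ρ₂(τ, y)^{-6}`. [folklore] -/
theorem heatKernel_le_slab {ν τ L : ℝ} (hν : 0 < ν) (hτ : 0 < τ) (hτL : τ ≤ L) (y : ℝ³) :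
    UnboundedOperators.heatKernel (ν * τ) y ≤
      gaussConst ν 3 * Real.sqrt L ^ 3 * parabolicNorm ((τ, y) : ℝ × ℝ³) ^ (-((5 : ℝ) + 1)) := by
  have hρ0 : 0 < parabolicNorm ((τ, y) : ℝ × ℝ³) := by
    rw [parabolicNorm_mk_of_nonneg hτ.le]
    have := Real.sqrt_pos.2 hτ
    linarith [norm_nonneg y]
  have hG := gaussConst_nonneg hν 3
  calc UnboundedOperators.heatKernel (ν * τ) y
      ≤ gaussConst ν 3 * Real.sqrt τ ^ 3 / parabolicNorm ((τ, y) : ℝ × ℝ³) ^ 6 :=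
        heatKernel_le_G3 hν hτ y
    _ ≤ gaussConst ν 3 * Real.sqrt L ^ 3 / parabolicNorm ((τ, y) : ℝ × ℝ³) ^ 6 := by
        gcongr
    _ = gaussConst ν 3 * Real.sqrt L ^ 3 * parabolicNorm ((τ, y) : ℝ × ℝ³) ^ (-((5 : ℝ) + 1)) := by
        rw [show -((5 : ℝ) + 1) = -(((6 : ℕ) : ℝ)) by norm_num, Real.rpow_neg hρ0.le,
          Real.rpow_natCast, div_eq_mul_inv]

/-- **Absolute convergence of the heat potential of time-cut Morrey data** (what makes the
function `h` of Prop. 13.4 well defined): if `F` is measurable, vanishes for `s ≤ T`, and satisfies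
the `L¹`-Morrey bound `∫∫_{Q_r(c)} |F| ≤ B r^d` with `3 < d < 6`, then for every `z`,
`w ↦ W₊(z - w) F(w)` is integrable on `ℝ × ℝ³`: near the pole `|W₊| ≤ G₃ρ₂⁻³` and the dyadic
estimate with `m = 3 < d` apply; away from it, on the support `T < s < t` of the integrand,
`W₊ ≤ G₃ (√(t - T))³ ρ₂⁻⁶` and the dyadic estimate with `m = 5`, `d < 6` apply. [cite: LemarieRieusset2016, Prop. 13.4 p. 464] -/
theorem integrable_heatKernelFwd_mul {ν : ℝ} (hν : 0 < ν) {F : ℝ × ℝ³ → ℂ} {B d T : ℝ}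
    (hF : Measurable F) (hB : 0 ≤ B) (hd3 : 3 < d) (hd6 : d < 6)
    (hFT : ∀ w : ℝ × ℝ³, w.1 ≤ T → F w = 0)
    (hMor : ∀ (c : ℝ × ℝ³) (r : ℝ), 0 < r →
      ∫⁻ w in FluidPDE.parabolicCylinderCentered r c, ‖F w‖ₑ ≤ ENNReal.ofReal (B * r ^ d))
    (z : ℝ × ℝ³) :
    Integrable (fun w => ((heatKernelFwd ν (z - w) : ℝ) : ℂ) * F w) := by
  have hKm : Measurable fun w : ℝ × ℝ³ => ((heatKernelFwd ν (z - w) : ℝ) : ℂ) :=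
    Complex.measurable_ofReal.comp ((measurable_heatKernelFwd ν).comp (measurable_const.sub measurable_id))
  have hFm : AEMeasurable (fun w => ‖F w‖ₑ) volume := hF.enorm.aemeasurable
  refine ⟨(hKm.mul hF).aestronglyMeasurable, ?_⟩
  -- the size bound near the pole
  have hK1 : ∀ w : ℝ × ℝ³,
      ‖((heatKernelFwd ν w : ℝ) : ℂ)‖ * parabolicNorm w ^ (3 : ℝ) ≤ gaussConst ν 3 :=
    heatKernelFwd_mul_parabolicNorm_pow_le hν
  have hK0 : ((heatKernelFwd ν (0 : ℝ × ℝ³) : ℝ) : ℂ) = 0 := by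
    rw [heatKernelFwd_zero]; simp
  have hnear : ∀ w, ‖((heatKernelFwd ν (z - w) : ℝ) : ℂ)‖ₑ * ‖F w‖ₑ ≤
      ENNReal.ofReal (gaussConst ν 3) *
        (ENNReal.ofReal (parabolicNorm (z - w) ^ (-(3 : ℝ))) * ‖F w‖ₑ) := fun w => by
    rw [← mul_assoc]
    exact mul_le_mul' (enorm_le_of_mul_rpow_le (K := fun w => ((heatKernelFwd ν w : ℝ) : ℂ))
      hK0 hK1 (z - w)) le_rfl
  -- the size bound on the slab, away from the pole
  set L : ℝ := max (z.1 - T) 0 with hL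
  set M : ℝ := gaussConst ν 3 * Real.sqrt L ^ 3 with hM
  have hM0 : 0 ≤ M := by
    have := gaussConst_nonneg hν 3
    positivity
  have hfar : ∀ w, ‖((heatKernelFwd ν (z - w) : ℝ) : ℂ)‖ₑ * ‖F w‖ₑ ≤
      ENNReal.ofReal M * (ENNReal.ofReal (parabolicNorm (z - w) ^ (-((5 : ℝ) + 1))) * ‖F w‖ₑ) := by
    intro w
    by_cases hFw : F w = 0
    · simp [hFw]
    have hwT : T < w.1 := lt_of_not_ge fun h => hFw (hFT w h)
    rcases le_or_gt (z - w).1 0 with hτ | hτ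
    · simp [heatKernelFwd_of_nonpos ν hτ]
    · rw [← mul_assoc]
      refine mul_le_mul' ?_ le_rfl
      have hτL : (z - w).1 ≤ L := by
        rw [Prod.fst_sub] at hτ ⊢
        exact le_trans (by linarith) (le_max_left _ _)
      rw [← ofReal_norm, Complex.norm_real, Real.norm_eq_abs, abs_of_nonneg (heatKernelFwd_nonneg hν _),
        ← ENNReal.ofReal_mul hM0, heatKernelFwd_of_pos ν hτ]
      exact ENNReal.ofReal_le_ofReal (heatKernel_le_slab hν hτ hτL (z - w).2)
  -- split the integral at the parabolic ball of radius `1`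
  have hball : MeasurableSet (parabolicBall z 1) := measurableSet_parabolicBall z 1
  unfold HasFiniteIntegral
  rw [← lintegral_add_compl _ hball]
  simp_rw [enorm_mul]
  refine ENNReal.add_lt_top.2 ⟨?_, ?_⟩
  · calc ∫⁻ w in parabolicBall z 1, ‖((heatKernelFwd ν (z - w) : ℝ) : ℂ)‖ₑ * ‖F w‖ₑ
        ≤ ∫⁻ w in parabolicBall z 1, ENNReal.ofReal (gaussConst ν 3) *
            (ENNReal.ofReal (parabolicNorm (z - w) ^ (-(3 : ℝ))) * ‖F w‖ₑ) :=
          lintegral_mono fun w => hnear w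
      _ = ENNReal.ofReal (gaussConst ν 3) * ∫⁻ w in parabolicBall z 1,
            ENNReal.ofReal (parabolicNorm (z - w) ^ (-(3 : ℝ))) * ‖F w‖ₑ :=
          lintegral_const_mul' _ _ ENNReal.ofReal_ne_top
      _ < ⊤ := by
          refine ENNReal.mul_lt_top ENNReal.ofReal_lt_top ?_
          exact (lintegral_parabolicBall_rpow_neg_mul_le hB (m := 3) (by norm_num) hd3 hFm hMor z
            one_pos).trans_lt ENNReal.ofReal_lt_top
  · calc ∫⁻ w in (parabolicBall z 1)ᶜ, ‖((heatKernelFwd ν (z - w) : ℝ) : ℂ)‖ₑ * ‖F w‖ₑ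
        ≤ ∫⁻ w in (parabolicBall z 1)ᶜ, ENNReal.ofReal M *
            (ENNReal.ofReal (parabolicNorm (z - w) ^ (-((5 : ℝ) + 1))) * ‖F w‖ₑ) :=
          lintegral_mono fun w => hfar w
      _ = ENNReal.ofReal M * ∫⁻ w in (parabolicBall z 1)ᶜ,
            ENNReal.ofReal (parabolicNorm (z - w) ^ (-((5 : ℝ) + 1))) * ‖F w‖ₑ :=
          lintegral_const_mul' _ _ ENNReal.ofReal_ne_top
      _ < ⊤ := by
          refine ENNReal.mul_lt_top ENNReal.ofReal_lt_top ?_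
          exact (lintegral_compl_parabolicBall_rpow_neg_mul_le hB (m := 5) (by norm_num)
            (by linarith) hFm hMor z one_pos).trans_lt ENNReal.ofReal_lt_top

end Convergence

end Literature.Analysis.FluidPDE
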